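/-
COR-CM (cell pub-hodgecm2, stage 2 of the Hodge ladder) — count-neutral KERNEL CENSUS TRANSPORT, INTRINSIC FORM, non-abelian octic types
(seat prover-pub-hodgecm2-b23-g33-0, binder prover b23, gen 33; claim INT2-INTRINSIC, HOME/lit/LIT-STATUS.md 2026-08-21T18:02Z; sequel of
`Census/OcticFaceTransportNonabelian.lean` and `CorCM/FaceCensusGroupDictionary.lean`). Theorems only; no definition, no named fact,
nothing asserted; seat b30's census dictionaries (`enum`, `table_spec`, `conj_spec` of `Census/OcticFaceSquares{Quaternion,Dihedral}`)
are consumed BY NAME; `Interfaces.lean` (C1), every E term, B01 and `Transposition/*` are untouched. HONEST FRAMING (COORDINATOR RULING —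
HODGE FRAMING CORRECTION, 2026-08-21T11:55:35Z): `HC_CM` is NOT proved, here or anywhere in the tree. Every closing theorem below is
CONDITIONAL on face-period witnesses (for ONE field, on the listed faces); no period is proved here.
T5 (coordinator ruling 15:33:56Z (3), lead staging l.4095): the DICTIONARY binders of the census transport (`ε`, `hε`, `c`, `hc`, `ε c = Γ.conj`
of the `…_aut` theorems) are DISCHARGED here from ONE standard hypothesis `e : Gal(K/ℚ) ≃* QuaternionGroup 2` resp. `≃* DihedralGroup 4`
(the hypothesis shape of `CorCM/GaloisDodecicBinders.lean`), inhabited by the fields listed in b30's census docstrings; the face-reading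
binders are inhabited in the kernel (`exists_face₁/₂_of_mulEquiv`); the only remaining hypotheses are the period witnesses on the listed faces
= instances of the crux (`FacePeriodExists` / B01-S), against which the tree has no `¬` theorem on the universe of record — no contradiction
derivable; checker: self (prover-pub-hodgecm2-b23-g33-0), 2026-08-21T19:00Z.
-/
import Summits.HodgeConjecture.CorCM.FaceCensusGroupDictionary
import Summits.HodgeConjecture.CorCM.Census.OcticFaceTransportNonabelian
import HarnessLib

/-!
# Galois CM fields with group `Q₈` or `D₄`: field closure from an isomorphism with the Mathlib group (census transport, intrinsic form)

The automorphism-form field-closure theorems `…_octicQuaternion_aut`, `…_octicDihedral_aut` of the census transport take an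
enumeration `ε : Aut(K) ≃ Fin 8` multiplicative for seat b30's Cayley table, the conjugation automorphism `c` at `σ₀` and `ε c = Γ.conj`
as hypotheses.  Here all of it is derived from ONE isomorphism `e : Gal(K/ℚ) ≃* QuaternionGroup 2` resp. `DihedralGroup 4`:
`ε := enum⁻¹ ∘ e` (`FaceCensus.exists_enum_of_groupEnum` over b30's certified `table_spec`), and complex conjugation reads `Γ.conj`
because it is an involution `≠ 1` of `Gal(K/ℚ)` — the unique one `a 2` of `Q₈` — resp. a CENTRAL involution `≠ 1` (`K` is CM, the
conjugation automorphism is `IsCMField.complexConj`, central) — the unique one `r 2` of `D₄`.  The generating faces of b30's census then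
read as explicit group data: base type `Φ₀ = {σ₀ ∘ h | e h ∈ {a 0, a 1, xa 0, xa 1}}` (resp. `{r 0, r 1, sr 0, sr 1}`), place
representatives `σ₀` and `σ₀ ∘ e⁻¹(x)`:

* `Q₈`: TWO faces `(Φ₀; σ₀, σ₀∘e⁻¹(a 1))`, `(Φ₀; σ₀, σ₀∘e⁻¹(xa 0))`;
* `D₄`: TWO faces `(Φ₀; σ₀, σ₀∘e⁻¹(r 1))`, `(Φ₀; σ₀, σ₀∘e⁻¹(sr 0))`.

Such faces exist for every `K`, `e`, `σ₀` (`exists_face₁/₂_of_mulEquiv`), and ONE period witness per face on the universe of record gives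
the Hodge conjecture for every complex abelian variety dominated by a product of CM abelian varieties with CM by subfields of `K`
(`…_mulEquiv`).  `HC_CM` is NOT proved and nothing here produces a period.

References: [cite: Pohlmann1968, Thm. 1]; [cite: Milne1999LefschetzClasses, Thm. 3.2 and Cor. 4.5];
[cite: Shimura1998, §6.2 Theorem 3 and §6.1 Corollary of Theorem 2 (pp. 41–43)]; [cite: MumfordAV1970, §19 Thm. 1 and p. 169].
-/

noncomputable section

open CategoryTheory NumberField NumberField.ComplexEmbedding
open Literature.AlgebraicGeometry Literature.AlgebraicGeometry.Motives Literature.AlgebraicGeometry.HodgeTheory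
open Literature.AlgebraicGeometry.ComplexMultiplication Literature.AlgebraicGeometry.Milne1999
open Literature.NumberTheory.Automorphic
open Literature.NumberTheory.Automorphic.PicardCM
open Summit.HodgeConjecture.CorCM.Domination

namespace Summit.HodgeConjecture.CorCM.OcticFaceTransport.Quaternion

open Summit.HodgeConjecture.CorCM.Census.FaceSquaresModel (mem)
open Summit.HodgeConjecture.CorCM.Census.OcticFaceSquaresQuaternion (Γ enum table_spec conj_spec)

/-- **The dictionary from an isomorphism with `QuaternionGroup 2`, type `Q₈`.**  `K` a Galois CM field, `e : Gal(K/ℚ) ≃* QuaternionGroup 2`,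
`σ₀` a base embedding.  Then there is an enumeration `ε : Aut(K) ≃ Fin 8`, multiplicative for seat b30's Cayley table, reading `e`
through b30's `enum` (`enum (ε h) = e h`), under which THE automorphism `c` inducing complex conjugation at `σ₀` reads `Γ.conj` — proved,
not assumed: complex conjugation is an involution `≠ 1`, and `a 2` is the ONLY involution of `Q₈` (`FaceCensus.quaternionGroup_two_involution`). [folklore] -/
theorem exists_autEnum_of_mulEquiv (K : CMField) [IsGalois ℚ K] (e : ((K : Type) ≃ₐ[ℚ] (K : Type)) ≃* QuaternionGroup 2) (σ₀ : (K : Type) →+* ℂ) :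
    ∃ ε : ((K : Type) ≃ₐ[ℚ] (K : Type)) ≃ Fin 8,
      (∀ x y : ((K : Type) ≃ₐ[ℚ] (K : Type)), ε (x * y) = Γ.mul (ε x) (ε y)) ∧ (∀ h : ((K : Type) ≃ₐ[ℚ] (K : Type)), enum (ε h) = e h) ∧
      (∀ (h : ((K : Type) ≃ₐ[ℚ] (K : Type))) (i : Fin 8), e h = enum i → ε h = i) ∧
      ∀ c : ((K : Type) ≃ₐ[ℚ] (K : Type)), σ₀.comp (c : (K : Type) →+* (K : Type)) = conjugate σ₀ → ε c = Γ.conj := by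
  obtain ⟨ε, hε, hread⟩ := FaceCensus.exists_enum_of_groupEnum Γ (· * ·) enum table_spec.1 table_spec.2
    (by rw [QuaternionGroup.card]) e e.bijective (map_mul e)
  refine ⟨ε, hε, hread, fun h i hh => table_spec.2 ((hread h).trans hh), fun c hc => table_spec.2 ?_⟩
  rw [hread, conj_spec]
  exact FaceCensus.quaternionGroup_two_involution _ ((MulEquiv.map_ne_one_iff e).mpr (FaceCensus.conjAut_ne_one σ₀ hc))
      (by rw [← map_mul, FaceCensus.conjAut_mul_self σ₀ hc, map_one])

/-- The common base type of the generating representatives, code `51`, read in `QuaternionGroup 2`. [folklore] -/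
theorem mem_51_iff_enum : ∀ i : Fin 8, mem i 51 = true ↔ enum i ∈ ({QuaternionGroup.a 0, QuaternionGroup.a 1, QuaternionGroup.xa 0, QuaternionGroup.xa 1} : Finset (QuaternionGroup 2)) := by
  decide

/-- **Non-vacuity, type `Q₈`, face 1.**  For `K`, `e`, `σ₀` as above there is a rank-four face `(Φ₀; σ₀, σ₀ ∘ e⁻¹(a 1))`:
base type `Φ₀` with `σ₀ ∘ h ∈ Φ₀ ↔ e h ∈ {a 0, a 1, xa 0, xa 1}`, place representatives `σ₀` and `σ₀ ∘ e⁻¹(a 1)`. [folklore] -/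
theorem exists_face₁_of_mulEquiv (K : CMField) [IsGalois ℚ K] (e : ((K : Type) ≃ₐ[ℚ] (K : Type)) ≃* QuaternionGroup 2) (σ₀ : (K : Type) →+* ℂ) :
    ∃ R : Face K, (∀ h : ((K : Type) ≃ₐ[ℚ] (K : Type)), σ₀.comp (h : (K : Type) →+* (K : Type)) ∈ R.Φ.1 ↔ e h ∈ ({QuaternionGroup.a 0, QuaternionGroup.a 1, QuaternionGroup.xa 0, QuaternionGroup.xa 1} : Finset (QuaternionGroup 2))) ∧
      R.p = σ₀ ∧ R.p' = σ₀.comp ((e.symm (QuaternionGroup.a 1) : ((K : Type) ≃ₐ[ℚ] (K : Type))) : (K : Type) →+* (K : Type)) := by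
  obtain ⟨ε, hε, hread, hidx, hconj⟩ := exists_autEnum_of_mulEquiv K e σ₀
  obtain ⟨c, hc⟩ := FaceCensus.exists_conjAut σ₀
  obtain ⟨e', hmul, he⟩ := FaceCensus.exists_enum_of_autEnum Γ σ₀ ε hε
  have hconj' : e' conjT = Γ.conj := by rw [FaceCensus.conjT_eq_translate σ₀, ← hc, he, hconj c hc]
  obtain ⟨R₀, hT₀, -, -⟩ := FaceCensus.exists_face_reads Γ e' hmul hconj' σ₀ (r := (51, 5, 10)) (by decide +kernel)
  have hq : ε (e.symm (QuaternionGroup.a 1)) = 1 := hidx _ _ (by rw [MulEquiv.apply_symm_apply]; decide)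
  have h1 : ε 1 = 0 := hidx _ _ (by rw [map_one]; decide)
  have hne' : InfinitePlace.mk (σ₀.comp ((1 : ((K : Type) ≃ₐ[ℚ] (K : Type))) : (K : Type) →+* (K : Type))) ≠
      InfinitePlace.mk (σ₀.comp ((e.symm (QuaternionGroup.a 1) : ((K : Type) ≃ₐ[ℚ] (K : Type))) : (K : Type) →+* (K : Type))) := by
    rw [Ne, FaceCensus.mk_comp_eq_mk_comp_iff σ₀ hc]
    rintro (h | h)
    · have := congrArg ε h; rw [h1, hq] at this; exact absurd this (by decide)
    · have := congrArg ε h; rw [mul_one, hconj c hc, hq] at this; exact absurd this (by decide)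
  have hne : InfinitePlace.mk σ₀ ≠ InfinitePlace.mk (σ₀.comp ((e.symm (QuaternionGroup.a 1) : ((K : Type) ≃ₐ[ℚ] (K : Type))) : (K : Type) →+* (K : Type))) := by
    rwa [FaceCensus.comp_coe_one] at hne'
  refine ⟨⟨R₀.Φ, _, _, hne⟩, fun h => ?_, rfl, rfl⟩
  have hk := hT₀.2 (e' (translate σ₀ (σ₀.comp (h : (K : Type) →+* (K : Type)))))
  rw [e'.symm_apply_apply, mem_pullType, translate_apply_self, he] at hk
  rw [← hread h]
  exact hk.symm.trans (mem_51_iff_enum (ε h))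

/-- **Non-vacuity, type `Q₈`, face 2.**  For `K`, `e`, `σ₀` as above there is a rank-four face `(Φ₀; σ₀, σ₀ ∘ e⁻¹(xa 0))`:
base type `Φ₀` with `σ₀ ∘ h ∈ Φ₀ ↔ e h ∈ {a 0, a 1, xa 0, xa 1}`, place representatives `σ₀` and `σ₀ ∘ e⁻¹(xa 0)`. [folklore] -/
theorem exists_face₂_of_mulEquiv (K : CMField) [IsGalois ℚ K] (e : ((K : Type) ≃ₐ[ℚ] (K : Type)) ≃* QuaternionGroup 2) (σ₀ : (K : Type) →+* ℂ) :
    ∃ R : Face K, (∀ h : ((K : Type) ≃ₐ[ℚ] (K : Type)), σ₀.comp (h : (K : Type) →+* (K : Type)) ∈ R.Φ.1 ↔ e h ∈ ({QuaternionGroup.a 0, QuaternionGroup.a 1, QuaternionGroup.xa 0, QuaternionGroup.xa 1} : Finset (QuaternionGroup 2))) ∧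
      R.p = σ₀ ∧ R.p' = σ₀.comp ((e.symm (QuaternionGroup.xa 0) : ((K : Type) ≃ₐ[ℚ] (K : Type))) : (K : Type) →+* (K : Type)) := by
  obtain ⟨ε, hε, hread, hidx, hconj⟩ := exists_autEnum_of_mulEquiv K e σ₀
  obtain ⟨c, hc⟩ := FaceCensus.exists_conjAut σ₀
  obtain ⟨e', hmul, he⟩ := FaceCensus.exists_enum_of_autEnum Γ σ₀ ε hε
  have hconj' : e' conjT = Γ.conj := by rw [FaceCensus.conjT_eq_translate σ₀, ← hc, he, hconj c hc]
  obtain ⟨R₀, hT₀, -, -⟩ := FaceCensus.exists_face_reads Γ e' hmul hconj' σ₀ (r := (51, 5, 80)) (by decide +kernel)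
  have hq : ε (e.symm (QuaternionGroup.xa 0)) = 4 := hidx _ _ (by rw [MulEquiv.apply_symm_apply]; decide)
  have h1 : ε 1 = 0 := hidx _ _ (by rw [map_one]; decide)
  have hne' : InfinitePlace.mk (σ₀.comp ((1 : ((K : Type) ≃ₐ[ℚ] (K : Type))) : (K : Type) →+* (K : Type))) ≠
      InfinitePlace.mk (σ₀.comp ((e.symm (QuaternionGroup.xa 0) : ((K : Type) ≃ₐ[ℚ] (K : Type))) : (K : Type) →+* (K : Type))) := by
    rw [Ne, FaceCensus.mk_comp_eq_mk_comp_iff σ₀ hc]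
    rintro (h | h)
    · have := congrArg ε h; rw [h1, hq] at this; exact absurd this (by decide)
    · have := congrArg ε h; rw [mul_one, hconj c hc, hq] at this; exact absurd this (by decide)
  have hne : InfinitePlace.mk σ₀ ≠ InfinitePlace.mk (σ₀.comp ((e.symm (QuaternionGroup.xa 0) : ((K : Type) ≃ₐ[ℚ] (K : Type))) : (K : Type) →+* (K : Type))) := by
    rwa [FaceCensus.comp_coe_one] at hne'
  refine ⟨⟨R₀.Φ, _, _, hne⟩, fun h => ?_, rfl, rfl⟩
  have hk := hT₀.2 (e' (translate σ₀ (σ₀.comp (h : (K : Type) →+* (K : Type)))))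
  rw [e'.symm_apply_apply, mem_pullType, translate_apply_self, he] at hk
  rw [← hread h]
  exact hk.symm.trans (mem_51_iff_enum (ε h))

/-- **FIELD CLOSURE FROM `Gal(K/ℚ) ≃* QuaternionGroup 2`, type `Q₈` — CLOSED, headline.**  `K` a Galois CM field with an isomorphism
`e : Gal(K/ℚ) ≃* QuaternionGroup 2` (so `[K:ℚ] = 8`); `σ₀` a base embedding; `Φ₀` the CM type with `σ₀ ∘ h ∈ Φ₀ ↔ e h ∈ {a 0, a 1, xa 0, xa 1}`; the TWO faces
`R₁ = (Φ₀; σ₀, σ₀ ∘ e⁻¹(a 1))` and `R₂ = (Φ₀; σ₀, σ₀ ∘ e⁻¹(xa 0))` (they exist: `exists_face₁_of_mulEquiv`, `exists_face₂_of_mulEquiv`).  ONE period witness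
for each on the universe of record implies the Hodge conjecture, in every codimension, for every complex abelian variety dominated by
a finite product of abelian varieties realising CM types of CM fields embeddable in `K`.  No enumeration, table or conjugation
hypothesis is left (`exists_autEnum_of_mulEquiv`).  (FRAMING: conditional on these two face periods; `HC_CM` is NOT proved.)
[cite: Shimura1998, §6.2 Theorem 3 and §6.1 Corollary of Theorem 2 (pp. 41–43)] [cite: Pohlmann1968, Thm. 1]
[cite: Milne1999LefschetzClasses, Thm. 3.2 and Cor. 4.5] [cite: MumfordAV1970, §19 Thm. 1 and p. 169] -/
theorem hodgeConjectureFor_of_avDominatedBy_isProductOf_of_facePeriod_octicQuaternion_mulEquiv (K : CMField) [IsGalois ℚ K]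
    (e : ((K : Type) ≃ₐ[ℚ] (K : Type)) ≃* QuaternionGroup 2) (σ₀ : (K : Type) →+* ℂ) (R₁ R₂ : Face K)
    (hΦ₁ : ∀ h : ((K : Type) ≃ₐ[ℚ] (K : Type)), σ₀.comp (h : (K : Type) →+* (K : Type)) ∈ R₁.Φ.1 ↔ e h ∈ ({QuaternionGroup.a 0, QuaternionGroup.a 1, QuaternionGroup.xa 0, QuaternionGroup.xa 1} : Finset (QuaternionGroup 2)))
    (hp₁ : R₁.p = σ₀) (hq₁ : R₁.p' = σ₀.comp ((e.symm (QuaternionGroup.a 1) : ((K : Type) ≃ₐ[ℚ] (K : Type))) : (K : Type) →+* (K : Type)))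
    (hΦ₂ : ∀ h : ((K : Type) ≃ₐ[ℚ] (K : Type)), σ₀.comp (h : (K : Type) →+* (K : Type)) ∈ R₂.Φ.1 ↔ e h ∈ ({QuaternionGroup.a 0, QuaternionGroup.a 1, QuaternionGroup.xa 0, QuaternionGroup.xa 1} : Finset (QuaternionGroup 2)))
    (hp₂ : R₂.p = σ₀) (hq₂ : R₂.p' = σ₀.comp ((e.symm (QuaternionGroup.xa 0) : ((K : Type) ≃ₐ[ℚ] (K : Type))) : (K : Type) →+* (K : Type)))
    (h₁ : ∃ ι₁ : K →+* ℂ, R₁.Admissible ι₁ ∧ ∃ (V : HermSpace3 K ι₁) (σ : K →+* ℂ),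
      (Model.picardCMUniverse exists_isReal_hodgeModel_holds hodgePQ_independent_of_hodgeModel_holds
        BallQuotient.ballQuotientUniformised_holds cmAbelianVarietyRealised_holds).PeriodNV ι₁ V K R₁.psi σ)
    (h₂ : ∃ ι₁ : K →+* ℂ, R₂.Admissible ι₁ ∧ ∃ (V : HermSpace3 K ι₁) (σ : K →+* ℂ),
      (Model.picardCMUniverse exists_isReal_hodgeModel_holds hodgePQ_independent_of_hodgeModel_holds
        BallQuotient.ballQuotientUniformised_holds cmAbelianVarietyRealised_holds).PeriodNV ι₁ V K R₂.psi σ)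
    {P A : AbelianVariety ℂ} (hP : AbelianVariety.IsProductOf (fun B : AbelianVariety ℂ =>
      ∃ (E : Type) (_ : Field E) (_ : NumberField E) (_ : IsCMField E) (_ : E →+* (K : Type)) (Φ : CMType E)
        (ι : 𝓞 E →+* End B) (θ : E →+* Module.End ℂ (complexBetti B.X 1)),
        IsCMTypeRealisation Φ B ι θ) P)
    (hA : AVDominatedBy A P) : HodgeConjectureFor A.dim A.X := by
  obtain ⟨ε, hε, hread, hidx, hconj⟩ := exists_autEnum_of_mulEquiv K e σ₀
  obtain ⟨c, hc⟩ := FaceCensus.exists_conjAut σ₀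
  refine hodgeConjectureFor_of_avDominatedBy_isProductOf_of_facePeriod_octicQuaternion_aut K σ₀ ε hε c hc (hconj c hc) R₁ R₂
    1 (e.symm (QuaternionGroup.a 1)) 1 (e.symm (QuaternionGroup.xa 0))
    ?_ ?_ ?_ ?_ ?_ ?_ ?_ ?_ ?_ ?_ h₁ h₂ hP hA
  · intro h
    rw [hΦ₁, ← hread h]
    exact (mem_51_iff_enum (ε h)).symm
  · rw [hp₁, FaceCensus.comp_coe_one]
  · rw [hidx 1 0 (by rw [map_one]; decide)]; decide
  · exact hq₁
  · rw [hidx _ 1 (by rw [MulEquiv.apply_symm_apply]; decide)]; decide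
  · intro h
    rw [hΦ₂, ← hread h]
    exact (mem_51_iff_enum (ε h)).symm
  · rw [hp₂, FaceCensus.comp_coe_one]
  · rw [hidx 1 0 (by rw [map_one]; decide)]; decide
  · exact hq₂
  · rw [hidx _ 4 (by rw [MulEquiv.apply_symm_apply]; decide)]; decide

end Summit.HodgeConjecture.CorCM.OcticFaceTransport.Quaternion

namespace Summit.HodgeConjecture.CorCM.OcticFaceTransport.Dihedral

open Summit.HodgeConjecture.CorCM.Census.FaceSquaresModel (mem)
open Summit.HodgeConjecture.CorCM.Census.OcticFaceSquaresDihedral (Γ enum table_spec conj_spec)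

/-- **The dictionary from an isomorphism with `DihedralGroup 4`, type `D₄`.**  `K` a Galois CM field, `e : Gal(K/ℚ) ≃* DihedralGroup 4`,
`σ₀` a base embedding.  Then there is an enumeration `ε : Aut(K) ≃ Fin 8`, multiplicative for seat b30's Cayley table, reading `e`
through b30's `enum` (`enum (ε h) = e h`), under which THE automorphism `c` inducing complex conjugation at `σ₀` reads `Γ.conj` — proved,
not assumed: complex conjugation is a CENTRAL involution `≠ 1` of `Gal(K/ℚ)` (`K` is CM: `FaceCensus.conjAut_comm`), and `r 2` is the only central involution of `D₄` (`FaceCensus.dihedralGroup_four_central_involution`). [folklore] -/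
theorem exists_autEnum_of_mulEquiv (K : CMField) [IsGalois ℚ K] (e : ((K : Type) ≃ₐ[ℚ] (K : Type)) ≃* DihedralGroup 4) (σ₀ : (K : Type) →+* ℂ) :
    ∃ ε : ((K : Type) ≃ₐ[ℚ] (K : Type)) ≃ Fin 8,
      (∀ x y : ((K : Type) ≃ₐ[ℚ] (K : Type)), ε (x * y) = Γ.mul (ε x) (ε y)) ∧ (∀ h : ((K : Type) ≃ₐ[ℚ] (K : Type)), enum (ε h) = e h) ∧
      (∀ (h : ((K : Type) ≃ₐ[ℚ] (K : Type))) (i : Fin 8), e h = enum i → ε h = i) ∧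
      ∀ c : ((K : Type) ≃ₐ[ℚ] (K : Type)), σ₀.comp (c : (K : Type) →+* (K : Type)) = conjugate σ₀ → ε c = Γ.conj := by
  obtain ⟨ε, hε, hread⟩ := FaceCensus.exists_enum_of_groupEnum Γ (· * ·) enum table_spec.1 table_spec.2
    (by rw [DihedralGroup.card]) e e.bijective (map_mul e)
  refine ⟨ε, hε, hread, fun h i hh => table_spec.2 ((hread h).trans hh), fun c hc => table_spec.2 ?_⟩
  rw [hread, conj_spec]
  exact FaceCensus.dihedralGroup_four_central_involution _ ((MulEquiv.map_ne_one_iff e).mpr (FaceCensus.conjAut_ne_one σ₀ hc))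
      (by rw [← map_mul, FaceCensus.conjAut_mul_self σ₀ hc, map_one])
      (fun y => by
        obtain ⟨x, rfl⟩ := e.surjective y
        rw [← map_mul, ← map_mul, FaceCensus.conjAut_comm σ₀ hc x])

/-- The common base type of the generating representatives, code `51`, read in `DihedralGroup 4`. [folklore] -/
theorem mem_51_iff_enum : ∀ i : Fin 8, mem i 51 = true ↔ enum i ∈ ({DihedralGroup.r 0, DihedralGroup.r 1, DihedralGroup.sr 0, DihedralGroup.sr 1} : Finset (DihedralGroup 4)) := by
  decide

/-- **Non-vacuity, type `D₄`, face 1.**  For `K`, `e`, `σ₀` as above there is a rank-four face `(Φ₀; σ₀, σ₀ ∘ e⁻¹(r 1))`: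
base type `Φ₀` with `σ₀ ∘ h ∈ Φ₀ ↔ e h ∈ {r 0, r 1, sr 0, sr 1}`, place representatives `σ₀` and `σ₀ ∘ e⁻¹(r 1)`. [folklore] -/
theorem exists_face₁_of_mulEquiv (K : CMField) [IsGalois ℚ K] (e : ((K : Type) ≃ₐ[ℚ] (K : Type)) ≃* DihedralGroup 4) (σ₀ : (K : Type) →+* ℂ) :
    ∃ R : Face K, (∀ h : ((K : Type) ≃ₐ[ℚ] (K : Type)), σ₀.comp (h : (K : Type) →+* (K : Type)) ∈ R.Φ.1 ↔ e h ∈ ({DihedralGroup.r 0, DihedralGroup.r 1, DihedralGroup.sr 0, DihedralGroup.sr 1} : Finset (DihedralGroup 4))) ∧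
      R.p = σ₀ ∧ R.p' = σ₀.comp ((e.symm (DihedralGroup.r 1) : ((K : Type) ≃ₐ[ℚ] (K : Type))) : (K : Type) →+* (K : Type)) := by
  obtain ⟨ε, hε, hread, hidx, hconj⟩ := exists_autEnum_of_mulEquiv K e σ₀
  obtain ⟨c, hc⟩ := FaceCensus.exists_conjAut σ₀
  obtain ⟨e', hmul, he⟩ := FaceCensus.exists_enum_of_autEnum Γ σ₀ ε hε
  have hconj' : e' conjT = Γ.conj := by rw [FaceCensus.conjT_eq_translate σ₀, ← hc, he, hconj c hc]
  obtain ⟨R₀, hT₀, -, -⟩ := FaceCensus.exists_face_reads Γ e' hmul hconj' σ₀ (r := (51, 5, 10)) (by decide +kernel)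
  have hq : ε (e.symm (DihedralGroup.r 1)) = 1 := hidx _ _ (by rw [MulEquiv.apply_symm_apply]; decide)
  have h1 : ε 1 = 0 := hidx _ _ (by rw [map_one]; decide)
  have hne' : InfinitePlace.mk (σ₀.comp ((1 : ((K : Type) ≃ₐ[ℚ] (K : Type))) : (K : Type) →+* (K : Type))) ≠
      InfinitePlace.mk (σ₀.comp ((e.symm (DihedralGroup.r 1) : ((K : Type) ≃ₐ[ℚ] (K : Type))) : (K : Type) →+* (K : Type))) := by
    rw [Ne, FaceCensus.mk_comp_eq_mk_comp_iff σ₀ hc]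
    rintro (h | h)
    · have := congrArg ε h; rw [h1, hq] at this; exact absurd this (by decide)
    · have := congrArg ε h; rw [mul_one, hconj c hc, hq] at this; exact absurd this (by decide)
  have hne : InfinitePlace.mk σ₀ ≠ InfinitePlace.mk (σ₀.comp ((e.symm (DihedralGroup.r 1) : ((K : Type) ≃ₐ[ℚ] (K : Type))) : (K : Type) →+* (K : Type))) := by
    rwa [FaceCensus.comp_coe_one] at hne'
  refine ⟨⟨R₀.Φ, _, _, hne⟩, fun h => ?_, rfl, rfl⟩
  have hk := hT₀.2 (e' (translate σ₀ (σ₀.comp (h : (K : Type) →+* (K : Type)))))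
  rw [e'.symm_apply_apply, mem_pullType, translate_apply_self, he] at hk
  rw [← hread h]
  exact hk.symm.trans (mem_51_iff_enum (ε h))

/-- **Non-vacuity, type `D₄`, face 2.**  For `K`, `e`, `σ₀` as above there is a rank-four face `(Φ₀; σ₀, σ₀ ∘ e⁻¹(sr 0))`:
base type `Φ₀` with `σ₀ ∘ h ∈ Φ₀ ↔ e h ∈ {r 0, r 1, sr 0, sr 1}`, place representatives `σ₀` and `σ₀ ∘ e⁻¹(sr 0)`. [folklore] -/
theorem exists_face₂_of_mulEquiv (K : CMField) [IsGalois ℚ K] (e : ((K : Type) ≃ₐ[ℚ] (K : Type)) ≃* DihedralGroup 4) (σ₀ : (K : Type) →+* ℂ) :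
    ∃ R : Face K, (∀ h : ((K : Type) ≃ₐ[ℚ] (K : Type)), σ₀.comp (h : (K : Type) →+* (K : Type)) ∈ R.Φ.1 ↔ e h ∈ ({DihedralGroup.r 0, DihedralGroup.r 1, DihedralGroup.sr 0, DihedralGroup.sr 1} : Finset (DihedralGroup 4))) ∧
      R.p = σ₀ ∧ R.p' = σ₀.comp ((e.symm (DihedralGroup.sr 0) : ((K : Type) ≃ₐ[ℚ] (K : Type))) : (K : Type) →+* (K : Type)) := by
  obtain ⟨ε, hε, hread, hidx, hconj⟩ := exists_autEnum_of_mulEquiv K e σ₀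
  obtain ⟨c, hc⟩ := FaceCensus.exists_conjAut σ₀
  obtain ⟨e', hmul, he⟩ := FaceCensus.exists_enum_of_autEnum Γ σ₀ ε hε
  have hconj' : e' conjT = Γ.conj := by rw [FaceCensus.conjT_eq_translate σ₀, ← hc, he, hconj c hc]
  obtain ⟨R₀, hT₀, -, -⟩ := FaceCensus.exists_face_reads Γ e' hmul hconj' σ₀ (r := (51, 5, 80)) (by decide +kernel)
  have hq : ε (e.symm (DihedralGroup.sr 0)) = 4 := hidx _ _ (by rw [MulEquiv.apply_symm_apply]; decide)
  have h1 : ε 1 = 0 := hidx _ _ (by rw [map_one]; decide)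
  have hne' : InfinitePlace.mk (σ₀.comp ((1 : ((K : Type) ≃ₐ[ℚ] (K : Type))) : (K : Type) →+* (K : Type))) ≠
      InfinitePlace.mk (σ₀.comp ((e.symm (DihedralGroup.sr 0) : ((K : Type) ≃ₐ[ℚ] (K : Type))) : (K : Type) →+* (K : Type))) := by
    rw [Ne, FaceCensus.mk_comp_eq_mk_comp_iff σ₀ hc]
    rintro (h | h)
    · have := congrArg ε h; rw [h1, hq] at this; exact absurd this (by decide)
    · have := congrArg ε h; rw [mul_one, hconj c hc, hq] at this; exact absurd this (by decide)
  have hne : InfinitePlace.mk σ₀ ≠ InfinitePlace.mk (σ₀.comp ((e.symm (DihedralGroup.sr 0) : ((K : Type) ≃ₐ[ℚ] (K : Type))) : (K : Type) →+* (K : Type))) := by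
    rwa [FaceCensus.comp_coe_one] at hne'
  refine ⟨⟨R₀.Φ, _, _, hne⟩, fun h => ?_, rfl, rfl⟩
  have hk := hT₀.2 (e' (translate σ₀ (σ₀.comp (h : (K : Type) →+* (K : Type)))))
  rw [e'.symm_apply_apply, mem_pullType, translate_apply_self, he] at hk
  rw [← hread h]
  exact hk.symm.trans (mem_51_iff_enum (ε h))

/-- **FIELD CLOSURE FROM `Gal(K/ℚ) ≃* DihedralGroup 4`, type `D₄` — CLOSED, headline.**  `K` a Galois CM field with an isomorphism
`e : Gal(K/ℚ) ≃* DihedralGroup 4` (so `[K:ℚ] = 8`); `σ₀` a base embedding; `Φ₀` the CM type with `σ₀ ∘ h ∈ Φ₀ ↔ e h ∈ {r 0, r 1, sr 0, sr 1}`; the TWO faces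
`R₁ = (Φ₀; σ₀, σ₀ ∘ e⁻¹(r 1))` and `R₂ = (Φ₀; σ₀, σ₀ ∘ e⁻¹(sr 0))` (they exist: `exists_face₁_of_mulEquiv`, `exists_face₂_of_mulEquiv`).  ONE period witness
for each on the universe of record implies the Hodge conjecture, in every codimension, for every complex abelian variety dominated by
a finite product of abelian varieties realising CM types of CM fields embeddable in `K`.  No enumeration, table or conjugation
hypothesis is left (`exists_autEnum_of_mulEquiv`).  (FRAMING: conditional on these two face periods; `HC_CM` is NOT proved.)
[cite: Shimura1998, §6.2 Theorem 3 and §6.1 Corollary of Theorem 2 (pp. 41–43)] [cite: Pohlmann1968, Thm. 1]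
[cite: Milne1999LefschetzClasses, Thm. 3.2 and Cor. 4.5] [cite: MumfordAV1970, §19 Thm. 1 and p. 169] -/
theorem hodgeConjectureFor_of_avDominatedBy_isProductOf_of_facePeriod_octicDihedral_mulEquiv (K : CMField) [IsGalois ℚ K]
    (e : ((K : Type) ≃ₐ[ℚ] (K : Type)) ≃* DihedralGroup 4) (σ₀ : (K : Type) →+* ℂ) (R₁ R₂ : Face K)
    (hΦ₁ : ∀ h : ((K : Type) ≃ₐ[ℚ] (K : Type)), σ₀.comp (h : (K : Type) →+* (K : Type)) ∈ R₁.Φ.1 ↔ e h ∈ ({DihedralGroup.r 0, DihedralGroup.r 1, DihedralGroup.sr 0, DihedralGroup.sr 1} : Finset (DihedralGroup 4)))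
    (hp₁ : R₁.p = σ₀) (hq₁ : R₁.p' = σ₀.comp ((e.symm (DihedralGroup.r 1) : ((K : Type) ≃ₐ[ℚ] (K : Type))) : (K : Type) →+* (K : Type)))
    (hΦ₂ : ∀ h : ((K : Type) ≃ₐ[ℚ] (K : Type)), σ₀.comp (h : (K : Type) →+* (K : Type)) ∈ R₂.Φ.1 ↔ e h ∈ ({DihedralGroup.r 0, DihedralGroup.r 1, DihedralGroup.sr 0, DihedralGroup.sr 1} : Finset (DihedralGroup 4)))
    (hp₂ : R₂.p = σ₀) (hq₂ : R₂.p' = σ₀.comp ((e.symm (DihedralGroup.sr 0) : ((K : Type) ≃ₐ[ℚ] (K : Type))) : (K : Type) →+* (K : Type)))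
    (h₁ : ∃ ι₁ : K →+* ℂ, R₁.Admissible ι₁ ∧ ∃ (V : HermSpace3 K ι₁) (σ : K →+* ℂ),
      (Model.picardCMUniverse exists_isReal_hodgeModel_holds hodgePQ_independent_of_hodgeModel_holds
        BallQuotient.ballQuotientUniformised_holds cmAbelianVarietyRealised_holds).PeriodNV ι₁ V K R₁.psi σ)
    (h₂ : ∃ ι₁ : K →+* ℂ, R₂.Admissible ι₁ ∧ ∃ (V : HermSpace3 K ι₁) (σ : K →+* ℂ),
      (Model.picardCMUniverse exists_isReal_hodgeModel_holds hodgePQ_independent_of_hodgeModel_holds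
        BallQuotient.ballQuotientUniformised_holds cmAbelianVarietyRealised_holds).PeriodNV ι₁ V K R₂.psi σ)
    {P A : AbelianVariety ℂ} (hP : AbelianVariety.IsProductOf (fun B : AbelianVariety ℂ =>
      ∃ (E : Type) (_ : Field E) (_ : NumberField E) (_ : IsCMField E) (_ : E →+* (K : Type)) (Φ : CMType E)
        (ι : 𝓞 E →+* End B) (θ : E →+* Module.End ℂ (complexBetti B.X 1)),
        IsCMTypeRealisation Φ B ι θ) P)
    (hA : AVDominatedBy A P) : HodgeConjectureFor A.dim A.X := by
  obtain ⟨ε, hε, hread, hidx, hconj⟩ := exists_autEnum_of_mulEquiv K e σ₀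
  obtain ⟨c, hc⟩ := FaceCensus.exists_conjAut σ₀
  refine hodgeConjectureFor_of_avDominatedBy_isProductOf_of_facePeriod_octicDihedral_aut K σ₀ ε hε c hc (hconj c hc) R₁ R₂
    1 (e.symm (DihedralGroup.r 1)) 1 (e.symm (DihedralGroup.sr 0))
    ?_ ?_ ?_ ?_ ?_ ?_ ?_ ?_ ?_ ?_ h₁ h₂ hP hA
  · intro h
    rw [hΦ₁, ← hread h]
    exact (mem_51_iff_enum (ε h)).symm
  · rw [hp₁, FaceCensus.comp_coe_one]
  · rw [hidx 1 0 (by rw [map_one]; decide)]; decide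
  · exact hq₁
  · rw [hidx _ 1 (by rw [MulEquiv.apply_symm_apply]; decide)]; decide
  · intro h
    rw [hΦ₂, ← hread h]
    exact (mem_51_iff_enum (ε h)).symm
  · rw [hp₂, FaceCensus.comp_coe_one]
  · rw [hidx 1 0 (by rw [map_one]; decide)]; decide
  · exact hq₂
  · rw [hidx _ 4 (by rw [MulEquiv.apply_symm_apply]; decide)]; decide

end Summit.HodgeConjecture.CorCM.OcticFaceTransport.Dihedral

end
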